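import Summits.MatrixMultiplication.OmegaCensus.ThreeSetLineModFourSliceMasks
import Summits.MatrixMultiplication.OmegaCensus.ThreeSetLineModFourSlicePlanes
import HarnessLib

/-!
# The bit-sliced MOD-4 FILTER, V: soundness of the block checker, and block assembly

ω-census `pub-omega`, family (b3), seat pub-omega-group gen 42.  Framing: lottery ticket; floor = certified bounds/negative
ranges.  VALUE: a kernel TOOL for the three-set cube cells `(4, d, e)@p²` (`ThreeSetZpCells4Core`); NOT progress on ω.
**`dead_of_survMask_testBit_of_digits`** / **`dead_of_survMask_testBit`** (core: a zero survivor bit kills the datum whose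
residues the sliced data carry) and **`blockChk_sound`**: `LineMod.blockChk p K d e W pre n j sched = true` ⇒ no datum `Fl` of the block
`(ZpZpDomino.compsLit n j).map (pre ++ ·)` admits `G, s` with the three-set line identity
`Σ_u lineMat3 (vecFn W) (vecFn Fl) τ u · G u + [s = τ] = K` (the semantic killer shape `hkill` of `ThreeSetZpCells4Core`).
Proof: the datum's slice index `k` (`ThreeSetLineModFourSlicePlanes`); at bit `k` the sliced `α, β` are a mod-4 inverse
certificate (the two checked convolution identities, `…SliceMasks` + `…SliceLemmas`) and every hole fails the digit-sum test;
conclude by `LineMod.no_line_identity3_of_mod_cert` (`ThreeSetLineModFour`).  Also `forall_block_split` /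
`forall_of_forall_block_nil`: assembling blocks by the leading free entry (`compsLit.eq_2`).
Usage (one theorem per block, ≈ 10⁵ slice operations whatever the block size):
`theorem b : ∀ Fl ∈ (compsLit n j).map (pre ++ ·), … := LineMod.blockChk_sound (by decide +kernel : LineMod.blockChk … = true)`.
-/

namespace Summit.MatrixMultiplication.OmegaCensus

/-! # Soundness of the block checker -/

namespace LineMod

open Finset

/-- `seqV` only sequences. [folklore] -/
theorem seqV_eq {γ : Type} (f : List S2) (k : Unit → γ) : seqV f k = k () := by
  unfold seqV; split <;> rfl

section Sound

variable {p : ℕ} [NeZero p]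

/-- A list read through `vecFn` sums to its `List.sum` when its length is `p`. [folklore] -/
theorem sum_vecFn_eq {l : List ℕ} (hl : l.length = p) : ∑ v : ZMod p, vecFn l v = l.sum := by
  unfold vecFn
  rw [LineInv.sum_zmod_val (fun i => l.getD i 0), LineInv.sum_eq_sum_getD, hl]

/-- **Core of the soundness argument.**  With the parameter facts of the checker, a datum `Fl` (length `p`, sum `d`)
whose residues mod 4 are carried by datum `k < L` of the sliced data `X`, and a ZERO bit `k` of the survivor mask, `Fl` admits
no solution. [folklore] -/
theorem dead_of_survMask_testBit_of_digits {K d e L k : ℕ} {W Fl : List ℕ} {X : List S2} {sched : List Bool}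
    (hp3 : 3 * p < 256) (hWlen : W.length = p) (hFlen : Fl.length = p) (hFsum : Fl.sum = d) (hc : 0 < W.sum * d)
    (he : 3 * (W.sum * d) * e + 1 = p * K) (hk : k < L)
    (hXF : ∀ v : ZMod p, toF p k X v = ((vecFn Fl v : ℕ) : ZMod 4))
    (hsm : (survMask p (onesOf L) K e W X sched).testBit k = false) :
    ∀ (G : ZMod p → ℕ) (s : ZMod p),
      ¬ ∀ τ : ZMod p, (∑ u : ZMod p, lineMat3 (vecFn W) (vecFn Fl) τ u * G u) + (if s = τ then 1 else 0) = K := by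
  intro G s
  -- names for the pieces of the sliced computation
  set ones := onesOf L with hones
  set P := psl p W X
  set Q := qsl p W X
  set Pp := ppl p ones P
  set D := vsub p (conv2 p Pp Pp) (conv2 p Q (hatv p Q))
  set z0 := liftF2 p (towerF2 p (loPlanes p D) sched).1
  set T := conv2 p D z0
  set z := conv2 p z0 (newtonU p ones T)
  set α := conv2 p z Pp
  set β := vneg p (conv2 p z Q)
  set C1 := vadd p (conv2 p α Pp) (conv2 p β (hatv p Q))
  set C2 := vadd p (conv2 p α Q) (conv2 p β (hatv p Pp))
  set c0 := smul2 (K + e) (vsumTo (vadd p α β) p)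
  set α' := vneg p α
  set β' := vneg p β
  have hsm' : (((ndMask p ones C1 ||| nzMask C2 p) ||| passMask p ones e c0 α' β' p) &&& ones).testBit k = false := by
    have h0 := hsm
    simp only [survMask, seqV_eq] at h0
    exact h0
  -- bit `k`
  have hone : ones.testBit k = true := by
    rw [hones]; unfold onesOf; rw [Nat.testBit_two_pow_sub_one]; simp [hk]
  simp only [Nat.testBit_land, Nat.testBit_lor, hone, Bool.and_true, Bool.or_eq_false_iff] at hsm'
  obtain ⟨⟨hnd, hnz⟩, hpm⟩ := hsm'
  set F : ZMod p → ℕ := vecFn Fl with hF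
  -- semantics of the pieces
  have hPp : toF p k Pp = fun x => psym (vecFn W) F x + 1 := by
    show toF p k (ppl p (onesOf L) P) = _
    rw [toF_ppl hk, toF_psl k W X F hXF]
  have hQ : toF p k Q = qsym (vecFn W) F := toF_qsl k W X F hXF
  have eC1 : toF p k C1 = fun t => cconv (toF p k α) (fun x => psym (vecFn W) F x + 1) t +
      cconv (toF p k β) (fun x => qsym (R := ZMod 4) (vecFn W) F (-x)) t := by
    show toF p k (vadd p (conv2 p α Pp) (conv2 p β (hatv p Q))) = _
    rw [toF_vadd, toF_conv2 k α Pp, toF_conv2 k β (hatv p Q), toF_hatv k Q, hPp, hQ]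
  have eC2 : toF p k C2 = fun t => cconv (toF p k α) (qsym (vecFn W) F) t +
      cconv (toF p k β) (fun x => psym (R := ZMod 4) (vecFn W) F (-x) + 1) t := by
    show toF p k (vadd p (conv2 p α Q) (conv2 p β (hatv p Pp))) = _
    rw [toF_vadd, toF_conv2 k α Q, toF_conv2 k β (hatv p Pp), toF_hatv k Pp, hPp, hQ]
  have h1 : ∀ t, cconv (toF p k α) (fun x => psym (vecFn W) F x + 1) t +
      cconv (toF p k β) (fun x => qsym (R := ZMod 4) (vecFn W) F (-x)) t = if t = 0 then 1 else 0 := by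
    intro t
    have hd := val2_eq_delta_of_ndMask hk C1 hnd t.val (ZMod.val_lt t)
    rw [← congrFun eC1 t]
    show val2 k (vget C1 t.val) = _
    rw [hd]
    by_cases ht : t = 0
    · rw [if_pos ht, if_pos ((ZMod.val_eq_zero t).2 ht)]
    · rw [if_neg ht, if_neg (fun h => ht ((ZMod.val_eq_zero t).1 h))]
  have h2 : ∀ t, cconv (toF p k α) (qsym (vecFn W) F) t +
      cconv (toF p k β) (fun x => psym (R := ZMod 4) (vecFn W) F (-x) + 1) t = 0 := by
    intro t
    have hz := val2_eq_zero_of_nzMask C2 p hnz t.val (ZMod.val_lt t)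
    rw [← congrFun eC2 t]
    exact hz
  have hc' : 0 < (∑ v : ZMod p, vecFn W v) * ∑ v : ZMod p, F v := by
    rw [hF, sum_vecFn_eq hWlen, sum_vecFn_eq hFlen, hFsum]
    exact hc
  have he' : 3 * ((∑ v : ZMod p, vecFn W v) * ∑ v : ZMod p, F v) * e + 1 = p * K := by
    rw [hF, sum_vecFn_eq hWlen, sum_vecFn_eq hFlen, hFsum]
    exact he
  have hfail : ∀ s : ZMod p, e < ∑ v : ZMod p,
      (((K + e : ℕ) : ZMod 4) * (∑ t : ZMod p, (toF p k α t + toF p k β t)) - toF p k α (v - s) - toF p k β (v + s)).val := by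
    intro s
    have hlt := lt_digit_sum_of_holePass hk hp3 c0 α' β' s.val (holePass_false_of_passMask p ones e c0 α' β' p hpm s.val (ZMod.val_lt s))
    have hsumeq : ∑ v ∈ range p, (val2 k (vget (holeVec p c0 α' β' s.val) v)).val =
        ∑ v : ZMod p, (toF p k (holeVec p c0 α' β' s.val) v).val := (sum_zmod_val' _).symm
    rw [hsumeq, toF_holeVec k c0 α' β' (ZMod.val_lt s), ZMod.natCast_zmod_val] at hlt
    have hc0 : val2 k c0 = ((K + e : ℕ) : ZMod 4) * ∑ t : ZMod p, (toF p k α t + toF p k β t) := by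
      show val2 k (smul2 (K + e) (vsumTo (vadd p α β) p)) = _
      rw [val2_smul2, val2_vsumTo_eq, toF_vadd, Nat.cast_add]
    have hα' : toF p k α' = fun v => -toF p k α v := toF_vneg k α
    have hβ' : toF p k β' = fun v => -toF p k β v := toF_vneg k β
    simp only [hc0, hα', hβ'] at hlt
    convert hlt using 3
    ring
  exact no_line_identity3_of_mod_cert (vecFn W) F K e hc' he' (toF p k α) (toF p k β) h1 h2 hfail G s

/-- The planes version: a member `l` of `compsLit n j` carried by datum `k` of the block planes, with a zero survivor bit,
gives no solution for `pre ++ l`. [folklore] -/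
theorem dead_of_survMask_testBit {K d e : ℕ} {W pre : List ℕ} {n j : ℕ} {sched : List Bool}
    (hp3 : 3 * p < 256) (hWlen : W.length = p) (hlen : pre.length + n = p) (hsum : pre.sum + j = d) (hc : 0 < W.sum * d)
    (he : 3 * (W.sum * d) * e + 1 = p * K) {l : List ℕ} (hl : l ∈ ZpZpDomino.compsLit n j) {k : ℕ}
    (hk : k < (blockPlanes pre n j).1)
    (hbits : ∀ i b, b < 2 → (pl (blockPlanes pre n j).2 i b).testBit k = ((pre ++ l).getD i 0).testBit b)
    (hsm : (survMask p (onesOf (blockPlanes pre n j).1) K e W (sdigits p (blockPlanes pre n j).2) sched).testBit k = false) :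
    ∀ (G : ZMod p → ℕ) (s : ZMod p),
      ¬ ∀ τ : ZMod p, (∑ u : ZMod p, lineMat3 (vecFn W) (vecFn (pre ++ l)) τ u * G u) + (if s = τ then 1 else 0) = K := by
  obtain ⟨hllen, hlsum⟩ := length_sum_of_mem_compsLit n j l hl
  refine dead_of_survMask_testBit_of_digits hp3 hWlen (by rw [List.length_append, hllen, hlen])
    (by rw [List.sum_append, hlsum, hsum]) hc he hk (fun v => ?_) hsm
  unfold toF vecFn sdigits
  rw [vget_range_map _ (ZMod.val_lt v), natCast_eq_bits]
  unfold val2 bv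
  rw [show ((blockPlanes pre n j).2.getD v.val []).getD 0 0 = pl (blockPlanes pre n j).2 v.val 0 from rfl,
    show ((blockPlanes pre n j).2.getD v.val []).getD 1 0 = pl (blockPlanes pre n j).2 v.val 1 from rfl,
    hbits v.val 0 (by norm_num), hbits v.val 1 (by norm_num)]

/-- **Soundness of the bit-sliced mod-4 block checker.**  If `blockChk p K d e W pre n j sched = true`, then NO datum of the
block `(compsLit n j).map (pre ++ ·)` admits a solution of the three-set line identity with the killer `W` and the constant `K`
(for any `G`; the bound `G ≤ e` of the census statement is not even needed). [folklore] -/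
theorem blockChk_sound {K d e : ℕ} {W pre : List ℕ} {n j : ℕ} {sched : List Bool}
    (h : blockChk p K d e W pre n j sched = true) :
    ∀ Fl ∈ (ZpZpDomino.compsLit n j).map (pre ++ ·), ∀ (G : ZMod p → ℕ) (s : ZMod p), (∀ u, G u ≤ e) →
      ¬ ∀ τ : ZMod p, (∑ u : ZMod p, lineMat3 (vecFn W) (vecFn Fl) τ u * G u) + (if s = τ then 1 else 0) = K := by
  intro Fl hFl G s _
  unfold blockChk at h
  dsimp only at h
  simp only [Bool.and_eq_true, decide_eq_true_eq, beq_iff_eq] at h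
  obtain ⟨⟨⟨⟨⟨⟨⟨_, hp3⟩, hWlen⟩, hlen⟩, hsum⟩, hc⟩, he⟩, hsm⟩ := h
  rw [List.mem_map] at hFl
  obtain ⟨l, hl, rfl⟩ := hFl
  obtain ⟨_, hrep⟩ := blockPlanes_spec pre n j
  obtain ⟨k, hk, hbits⟩ := hrep l hl
  exact dead_of_survMask_testBit hp3 hWlen hlen hsum hc he hl hk hbits (by rw [hsm, Nat.zero_testBit]) G s

end Sound

end LineMod

/-! # Assembling blocks by the leading free entry -/

namespace LineMod

/-- **Block split.**  A block `(compsLit (n+1) j).map (pre ++ ·)` is the union of its children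
`(compsLit n (j − c)).map ((pre ++ [c]) ++ ·)`, `c ≤ j`. [folklore] -/
theorem forall_block_split {P : List ℕ → Prop} (pre : List ℕ) (n j : ℕ)
    (h : ∀ c, c ≤ j → ∀ Fl ∈ (ZpZpDomino.compsLit n (j - c)).map ((pre ++ [c]) ++ ·), P Fl) :
    ∀ Fl ∈ (ZpZpDomino.compsLit (n + 1) j).map (pre ++ ·), P Fl := by
  intro Fl hFl
  rw [List.mem_map] at hFl
  obtain ⟨l, hl, rfl⟩ := hFl
  rw [ZpZpDomino.compsLit, List.mem_flatMap] at hl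
  obtain ⟨c, hc, hl⟩ := hl
  rw [List.mem_map] at hl
  obtain ⟨l', hl', rfl⟩ := hl
  rw [List.mem_range] at hc
  exact h c (by omega) _ (List.mem_map.2 ⟨l', hl', by rw [List.append_assoc]; rfl⟩)

/-- The root block: `(compsLit n j).map ([] ++ ·)` is `compsLit n j`. [folklore] -/
theorem forall_of_forall_block_nil {P : List ℕ → Prop} (n j : ℕ)
    (h : ∀ Fl ∈ (ZpZpDomino.compsLit n j).map (([] : List ℕ) ++ ·), P Fl) : ∀ Fl ∈ ZpZpDomino.compsLit n j, P Fl :=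
  fun Fl hFl => h Fl (List.mem_map.2 ⟨Fl, hFl, rfl⟩)

end LineMod

end Summit.MatrixMultiplication.OmegaCensus
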